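/-
Origin: expansion seat `planner-pub-hodgecm-pv09-g4-0`, handover #12 2026-08-18T08:09:17Z (`HOME/pub-hodgecm-pv09-g4/lean/Pv09g4/RestrictedSumIndex.lean`, md5 e3ff6dd2, 188 lines);
landed by the gen-7 packager in gate run 26 as `HodgeCM/PerL34/RestrictedSumIndex.lean` (import ^import Pv[0-9]+g[0-9]+\.→import HodgeCM.PerL34. ×1).
-/
/-
HodgeCM / PerL34 publication cell — seam S3 set-up, model side (pub-hodgecm-pv09-g4, HANDOVER #12).
WIP imports: `Pv09g4.RestrictedUnits` ↦ `HodgeCM.PerL34.RestrictedUnits` at landing; otherwise Mathlib.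
Complete proofs, no new axioms, nothing cited.
-/
import Summits.HodgeConjecture.HodgeCM.PerL34.RestrictedUnits
import Mathlib.Topology.Homeomorph.Lemmas

/-!
# Restricted products over a sum of index sets; restricted products with no restriction

Two bookkeeping isomorphisms of topological groups (for topological groups `G i` with open subgroups
`B i`):

* `sumEquiv G B : (Πʳ i : ι₁ ⊕ ι₂, [G i, B i]) ≃ₜ* (Πʳ i, [G (inl i), B (inl i)]) × (Πʳ j, [G (inr j), B (inr j)])`;
* `topEquiv G B hB : (Πʳ i, [G i, B i]) ≃ₜ* Π i, G i` when every `B i = ⊤`.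

(Use in seam S3, GAPS pv09g4-A5: the ideles `𝔸_Lˣ = (L_∞)ˣ × Πʳ_{w fin} [L_wˣ, 𝒪_wˣ]` (pv10 / #9
`RestrictedUnits.ideleGroupEquiv`) become ONE restricted product over all places `InfinitePlace L ⊕ HeightOneSpectrum (𝓞 L)`,
with `B_w = ⊤` at the finitely many infinite places.)
-/

set_option autoImplicit false

noncomputable section

open Topology Filter Set Sum
open scoped RestrictedProduct

namespace HodgeCM.PerL34.RestrictedSumIndex

/-! ## §1  Sum of index sets -/

section sum

variable {ι₁ ι₂ : Type*} (G : ι₁ ⊕ ι₂ → Type*) [∀ i, Group (G i)] (B : ∀ i, Subgroup (G i))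

/-- First block of coordinates. -/
def fst (x : Πʳ i, [G i, B i]) : Πʳ i : ι₁, [G (inl i), B (inl i)] :=
  ⟨fun i => x (inl i), (Sum.inl_injective.tendsto_cofinite).eventually x.2⟩

/-- Second block of coordinates. -/
def snd (x : Πʳ i, [G i, B i]) : Πʳ j : ι₂, [G (inr j), B (inr j)] :=
  ⟨fun j => x (inr j), (Sum.inr_injective.tendsto_cofinite).eventually x.2⟩

/-- (Ported verbatim from the HodgeCMPerL package; no docstring in the source.) -/
@[simp] theorem fst_apply (x : Πʳ i, [G i, B i]) (i : ι₁) : fst G B x i = x (inl i) := rfl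
/-- (Ported verbatim from the HodgeCMPerL package; no docstring in the source.) -/
@[simp] theorem snd_apply (x : Πʳ i, [G i, B i]) (j : ι₂) : snd G B x j = x (inr j) := rfl

/-- Glue two blocks of coordinates. -/
def glue (y : (Πʳ i : ι₁, [G (inl i), B (inl i)]) × (Πʳ j : ι₂, [G (inr j), B (inr j)])) :
    Πʳ i, [G i, B i] :=
  ⟨fun i => match i with
      | inl i => y.1 i
      | inr j => y.2 j, by
    have h1 : Set.Finite {i : ι₁ | y.1 i ∉ (B (inl i) : Set (G (inl i)))} := by
      have h := y.1.2; rw [eventually_cofinite] at h; exact h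
    have h2 : Set.Finite {j : ι₂ | y.2 j ∉ (B (inr j) : Set (G (inr j)))} := by
      have h := y.2.2; rw [eventually_cofinite] at h; exact h
    rw [eventually_cofinite, ← finite_preimage_inl_and_inr]
    exact ⟨h1, h2⟩⟩

/-- (Ported verbatim from the HodgeCMPerL package; no docstring in the source.) -/
@[simp] theorem glue_apply_inl (y : (Πʳ i : ι₁, [G (inl i), B (inl i)]) × (Πʳ j : ι₂, [G (inr j), B (inr j)]))
    (i : ι₁) : glue G B y (inl i) = y.1 i := rfl
/-- (Ported verbatim from the HodgeCMPerL package; no docstring in the source.) -/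
@[simp] theorem glue_apply_inr (y : (Πʳ i : ι₁, [G (inl i), B (inl i)]) × (Πʳ j : ι₂, [G (inr j), B (inr j)]))
    (j : ι₂) : glue G B y (inr j) = y.2 j := rfl

/-- The algebraic isomorphism. -/
def sumMulEquiv : (Πʳ i, [G i, B i]) ≃* (Πʳ i : ι₁, [G (inl i), B (inl i)]) × (Πʳ j : ι₂, [G (inr j), B (inr j)]) where
  toFun x := (fst G B x, snd G B x)
  invFun := glue G B
  left_inv x := by
    ext i
    cases i with
    | inl i => rfl
    | inr j => rfl
  right_inv y := by
    apply Prod.ext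
    · ext i; rfl
    · ext j; rfl
  map_mul' x x' := by
    apply Prod.ext
    · ext i; rfl
    · ext j; rfl

variable [∀ i, TopologicalSpace (G i)]

/-- `fst` is continuous: it is Mathlib's `mapAlong` along `inl`. -/
theorem continuous_fst : Continuous (fst G B) :=
  RestrictedProduct.mapAlong_continuous G (fun i : ι₁ => G (inl i))
    (A₁ := fun i => (B i : Set (G i))) (A₂ := fun i : ι₁ => (B (inl i) : Set (G (inl i))))
    (𝓕₁ := cofinite) (𝓕₂ := cofinite) inl Sum.inl_injective.tendsto_cofinite (fun _ => id)
    (Eventually.of_forall fun _ _ hx => hx) (fun _ => continuous_id)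

/-- `snd` is continuous. -/
theorem continuous_snd : Continuous (snd G B) :=
  RestrictedProduct.mapAlong_continuous G (fun j : ι₂ => G (inr j))
    (A₁ := fun i => (B i : Set (G i))) (A₂ := fun j : ι₂ => (B (inr j) : Set (G (inr j))))
    (𝓕₁ := cofinite) (𝓕₂ := cofinite) inr Sum.inr_injective.tendsto_cofinite (fun _ => id)
    (Eventually.of_forall fun _ _ hx => hx) (fun _ => continuous_id)

variable [∀ i, IsTopologicalGroup (G i)] [hBo : Fact (∀ i, IsOpen (B i : Set (G i)))]

/-- (Ported verbatim from the HodgeCMPerL package; no docstring in the source.) -/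
instance fact_isOpen_inl : Fact (∀ i : ι₁, IsOpen (B (inl i) : Set (G (inl i)))) := ⟨fun i => hBo.out (inl i)⟩
/-- (Ported verbatim from the HodgeCMPerL package; no docstring in the source.) -/
instance fact_isOpen_inr : Fact (∀ j : ι₂, IsOpen (B (inr j) : Set (G (inr j)))) := ⟨fun j => hBo.out (inr j)⟩

/-- `glue` is continuous: tested on the open subgroup `(Π i, B (inl i)) × (Π j, B (inr j))`, on which it is
the structure map of the target composed with `Homeomorph.sumPiEquivProdPi`. -/
theorem continuous_glue : Continuous (glue G B) := by
  let i₀ : ((Π i : ι₁, B (inl i)) × (Π j : ι₂, B (inr j))) →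
      (Πʳ i : ι₁, [G (inl i), B (inl i)]) × (Πʳ j : ι₂, [G (inr j), B (inr j)]) :=
    Prod.map (RestrictedProduct.structureMap (fun i : ι₁ => G (inl i)) (fun i => (B (inl i) : Set (G (inl i)))) cofinite)
      (RestrictedProduct.structureMap (fun j : ι₂ => G (inr j)) (fun j => (B (inr j) : Set (G (inr j)))) cofinite)
  have hi₀ : IsOpenMap i₀ :=
    (RestrictedProduct.isOpenEmbedding_structureMap (fact_isOpen_inl G B).out).isOpenMap.prodMap
      (RestrictedProduct.isOpenEmbedding_structureMap (fact_isOpen_inr G B).out).isOpenMap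
  have h1 : i₀ 1 = 1 := rfl
  have hc : Continuous ((sumMulEquiv G B).symm.toMonoidHom ∘ i₀) := by
    have hfac : ((sumMulEquiv G B).symm.toMonoidHom ∘ i₀ :
        ((Π i : ι₁, B (inl i)) × (Π j : ι₂, B (inr j))) → Πʳ i, [G i, B i]) =
        RestrictedProduct.structureMap G (fun i => (B i : Set (G i))) cofinite ∘
          (Homeomorph.sumPiEquivProdPi ι₁ ι₂ (fun i => (B i : Type _))).symm := by
      funext y
      ext i
      cases i with
      | inl i => rfl
      | inr j => rfl
    rw [hfac]
    exact RestrictedProduct.isEmbedding_structureMap.continuous.comp (Homeomorph.continuous _)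
  exact RestrictedUnits.continuous_of_isOpenMap_comp (sumMulEquiv G B).symm.toMonoidHom i₀ hi₀ h1
    hc.continuousAt

/-- **A restricted product over `ι₁ ⊕ ι₂` is the product of the two restricted products**, as topological
groups. -/
def sumEquiv : (Πʳ i, [G i, B i]) ≃ₜ* (Πʳ i : ι₁, [G (inl i), B (inl i)]) × (Πʳ j : ι₂, [G (inr j), B (inr j)]) :=
  { sumMulEquiv G B with
    continuous_toFun := (continuous_fst G B).prodMk (continuous_snd G B)
    continuous_invFun := continuous_glue G B }

/-- (Ported verbatim from the HodgeCMPerL package; no docstring in the source.) -/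
@[simp] theorem sumEquiv_apply_fst (x : Πʳ i, [G i, B i]) (i : ι₁) : (sumEquiv G B x).1 i = x (inl i) := rfl
/-- (Ported verbatim from the HodgeCMPerL package; no docstring in the source.) -/
@[simp] theorem sumEquiv_apply_snd (x : Πʳ i, [G i, B i]) (j : ι₂) : (sumEquiv G B x).2 j = x (inr j) := rfl
/-- (Ported verbatim from the HodgeCMPerL package; no docstring in the source.) -/
@[simp] theorem sumEquiv_symm_apply_inl
    (y : (Πʳ i : ι₁, [G (inl i), B (inl i)]) × (Πʳ j : ι₂, [G (inr j), B (inr j)])) (i : ι₁) :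
    (sumEquiv G B).symm y (inl i) = y.1 i := rfl
/-- (Ported verbatim from the HodgeCMPerL package; no docstring in the source.) -/
@[simp] theorem sumEquiv_symm_apply_inr
    (y : (Πʳ i : ι₁, [G (inl i), B (inl i)]) × (Πʳ j : ι₂, [G (inr j), B (inr j)])) (j : ι₂) :
    (sumEquiv G B).symm y (inr j) = y.2 j := rfl

end sum

/-! ## §2  No restriction: `B i = ⊤` -/

section top

variable {ι : Type*} (G : ι → Type*) [∀ i, Group (G i)] [∀ i, TopologicalSpace (G i)]
  (B : ∀ i, Subgroup (G i)) (hB : ∀ i, B i = ⊤)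

omit [∀ i, TopologicalSpace (G i)] in
include hB in
/-- (Ported verbatim from the HodgeCMPerL package; no docstring in the source.) -/
theorem mem_of_eq_top (i : ι) (g : G i) : g ∈ (B i : Set (G i)) := by
  rw [hB i]; exact Subgroup.mem_top g

/-- With no restriction (`B i = ⊤`), the restricted product is the full product, as topological groups
(the underlying-function map; its inverse is the structure map up to `Π i, B i ≃ₜ Π i, G i`). -/
def topEquiv : (Πʳ i, [G i, B i]) ≃ₜ* (Π i, G i) where
  toFun x i := x i
  invFun x := ⟨x, Eventually.of_forall fun i => mem_of_eq_top G B hB i (x i)⟩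
  left_inv x := by ext i; rfl
  right_inv x := rfl
  map_mul' x y := rfl
  continuous_toFun := RestrictedProduct.continuous_coe
  continuous_invFun := by
    have hfac : (fun x : Π i, G i =>
        (⟨x, Eventually.of_forall fun i => mem_of_eq_top G B hB i (x i)⟩ : Πʳ i, [G i, B i])) =
        RestrictedProduct.structureMap G (fun i => (B i : Set (G i))) cofinite ∘
          fun x i => (⟨x i, mem_of_eq_top G B hB i (x i)⟩ : B i) := by
      funext x; ext i; rfl
    rw [hfac]
    exact RestrictedProduct.isEmbedding_structureMap.continuous.comp
      (continuous_pi fun i => (continuous_apply i).subtype_mk _)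

/-- (Ported verbatim from the HodgeCMPerL package; no docstring in the source.) -/
@[simp] theorem topEquiv_apply (x : Πʳ i, [G i, B i]) (i : ι) : topEquiv G B hB x i = x i := rfl
/-- (Ported verbatim from the HodgeCMPerL package; no docstring in the source.) -/
@[simp] theorem topEquiv_symm_apply (x : Π i, G i) (i : ι) : (topEquiv G B hB).symm x i = x i := rfl

end top

end HodgeCM.PerL34.RestrictedSumIndex

end
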